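import Summits.BirchSwinnertonDyer.BirchSwinnertonDyer.Theorems.ClassRecordThreeEulerHalvesAtThreeCartanCoverDefs
import Literature.NumberTheory.Automorphic.ShimuraCurveGroupDiscrete
import HarnessLib

/-!
# Crux NUM `CartanOnePlaceDegreeLawAtThree` (item 24801), line `lattice` — the print clauses V: MINKOWSKI'S LEMMA FOR QUATERNION ORDERS — an element of finite order of an
# order `O` congruent to `1` modulo `ℓ·O` (`ℓ` an odd prime) is `1`; the principal level-`ℓ` subgroups of `ι(O¹)` are TORSION-FREE

Seat `bsd-stepL-tam3-p1` g29 (LEAD of crux 24801; `--supports stmt-BirchSwinnertonDyer-24801 --as helper`). First brick (E1 of the LEAD's roadmap, NOTES/HANDOFF) of the in-tree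
route to the SURJECTIVITY half of (ESᶜ) `eichlerShimura_weightTwo_rePeriod` at `D > 1`: a torsion-free normal subgroup of finite index `Γ(ℓ) ⊴ ι(O¹)` acts FREELY on `ℍ`,
so that `Γ(ℓ)∖ℍ` is a compact Riemann surface to which the tree's `RiemannSurface.existsUnique_re_period_eq` (Farkas–Kra III.3.4 (b), existence) applies. It is also the
«neatness» input of the crux's alternative line `Lines/mirabolic.lean` ((NJ): «principal level ≥ 3 in quaternion unit groups is torsion-free, Minkowski»).

MINKOWSKI'S LEMMA (Minkowski 1887 for `GL_n(ℤ)`; Serre, *Cohomologie des groupes discrets* §1.8; Brown II.4 Ex. 3; the tree has the `GL_n(𝓞_K)` version in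
`Literature/NumberTheory/NumberFields/CongruenceSubgroupTorsionFree`, by valuations; for a non-commutative order we argue by the `ℓ`-adic filtration of the lattice):

* §1 `one_add_pow_eq` — `(1 + Y)^k = 1 + k•Y + C(k,2)•Y² + Y³ Z` with `Z` in the subring generated by `Y` (here: in any subring containing `Y`).
* §2 **`sub_one_mem_smul_of_pow_prime_eq_one`** — the filtration step: for `x ∈ O` with `x^p = 1` (`p` prime) and `x − 1 ∈ ℓ^k·O`, `k ≥ 1`, `ℓ` an ODD prime: `x − 1 ∈ ℓ^{k+1}·O`
  (write `x = 1 + ℓ^k y`; then `p y = −ℓ^k (C(p,2) y² + ℓ^k y³ Z) ∈ ℓ O`; if `p ≠ ℓ` Bezout gives `y ∈ ℓ O`; if `p = ℓ` then `C(ℓ,2) = ℓ(ℓ−1)/2` gives `y ∈ ℓ^k O ⊆ ℓ O`).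
  Hence `x − 1 ∈ ⋂_k ℓ^k O = 0` (**`eq_zero_of_forall_mem_pow_smul`**: coordinates in a `ℤ`-basis of the full lattice `O`) and **`eq_one_of_pow_prime_eq_one`**; with the reduction
  of a finite order to a prime order (`orderOf`), **`eq_one_of_isOfFinOrder_of_sub_one_mem`**: an element of finite order of `O` (as a unit of `B`, or `x^n = 1`) congruent to `1`
  modulo `ℓ O` is `1`.
* §3 groups: **`eq_one_of_isOfFinOrder_of_mem_normOneUnits`** — `γ ∈ ι(O¹)` of finite order with `γ = ι(x)`, `x ≡ 1 (mod ℓ O)`, is `1`; for a Cartan datum and an ODD place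
  `q`: **`principalLevel_torsionFree`** — the principal level-`q` subgroup `Γ̄(q) = CartanCover.principalLevel X q` of the cover group has no non-trivial element of finite
  order; in particular `−1 ∉ Γ̄(q)` (`neg_one_not_mem_principalLevel`) and every stabiliser of a point of `ℍ` in `Γ̄(q)` is trivial once it is finite
  (`principalLevel` acts freely: `smul_eq_self_iff_eq_one_of_finite_stabilizer`).

Theorems only; nothing about NUM or any curve is proved; BSD is proved for no curve.
[cite: Serre1971CohomologieGroupesDiscrets, §1.8] [cite: Brown1982CohomologyGroups, II.4 Exercise 3] [cite: Bergeron2016, §2.3 Cor. 2.11 p. 44 and p. 52]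
-/

set_option linter.dupNamespace false
set_option autoImplicit false

noncomputable section

open scoped MatrixGroups
open Function Set

namespace Summit.BirchSwinnertonDyer.BirchSwinnertonDyer.Theorems.CartanCover.PrintClauses

open Literature.NumberTheory.Automorphic

/-! ## §1 The binomial expansion to third order inside a subring -/

section Binomial

variable {A : Type*} [Ring A]

/-- `(1 + Y)^k = 1 + k•Y + C(k,2)•Y² + Y³ Z` with `Z` in any subring `S ∋ Y`. [folklore]
-- adapted from Literature/NumberTheory/NumberFields/CongruenceSubgroupTorsionFree.lean `exists_one_add_pow_eq` (there: `Z : A`) -/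
theorem exists_one_add_pow_eq_mem (S : Subring A) {Y : A} (hY : Y ∈ S) (k : ℕ) :
    ∃ Z ∈ S, (1 + Y) ^ k = 1 + k • Y + (k.choose 2) • Y ^ 2 + Y ^ 3 * Z := by
  induction k with
  | zero => exact ⟨0, S.zero_mem, by simp⟩
  | succ k ih =>
    obtain ⟨Z, hZ, hZeq⟩ := ih
    refine ⟨(k.choose 2) • 1 + Z + Z * Y, S.add_mem (S.add_mem (S.nsmul_mem S.one_mem _) hZ) (S.mul_mem hZ hY), ?_⟩
    rw [pow_succ, hZeq, Nat.choose_succ_succ, Nat.choose_one_right, add_smul, add_smul, one_smul]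
    noncomm_ring

end Binomial

/-! ## §2 Minkowski's lemma for an order of a quaternion algebra -/

section Minkowski

variable {B : Type*} [Ring B] [Algebra ℚ B] [IsQuaternionAlgebra ℚ B] {O : Submodule ℤ B}

omit [Algebra ℚ B] [IsQuaternionAlgebra ℚ B] in
/-- The subring of `B` underlying an order. [folklore] -/
theorem exists_subring_coe_eq (hO : Brandt.IsOrder B O) : ∃ S : Subring B, (S : Set B) = O :=
  ⟨{ carrier := O, mul_mem' := fun ha hb => hO.mul_mem _ ha _ hb, one_mem' := hO.one_mem,
     add_mem' := fun ha hb => O.add_mem ha hb, zero_mem' := O.zero_mem, neg_mem' := fun ha => O.neg_mem ha }, rfl⟩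

/-- **`⋂_k ℓ^k·O = 0`**: an element of the full lattice `O` divisible by every power of `ℓ ≥ 2` is zero (coordinates in a `ℤ`-basis). [folklore] -/
theorem eq_zero_of_forall_mem_pow_smul (hO : Brandt.IsOrder B O) {ℓ : ℕ} (hℓ : 2 ≤ ℓ) {z : B}
    (hz : ∀ k : ℕ, ∃ w ∈ O, z = ((ℓ : ℤ) ^ k) • w) : z = 0 := by
  classical
  obtain ⟨b⟩ := hO.isFullLattice.nonempty_basis_fin_four
  obtain ⟨w₀, hw₀, hz₀⟩ := hz 0
  rw [pow_zero, one_smul] at hz₀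
  -- every coordinate of `z` is divisible by every `ℓ^k`
  have hcoord : ∀ i k, ((ℓ : ℤ) ^ k) ∣ b.repr ⟨z, hz₀ ▸ hw₀⟩ i := by
    intro i k
    obtain ⟨w, hw, hzw⟩ := hz k
    have h1 : (⟨z, hz₀ ▸ hw₀⟩ : O) = ((ℓ : ℤ) ^ k) • (⟨w, hw⟩ : O) := Subtype.ext (by simpa using hzw)
    rw [h1, map_smul, Finsupp.smul_apply, smul_eq_mul]
    exact dvd_mul_right _ _
  have hzero : ∀ i, b.repr ⟨z, hz₀ ▸ hw₀⟩ i = 0 := by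
    intro i
    by_contra hne
    set c := b.repr ⟨z, hz₀ ▸ hw₀⟩ i
    have hk := hcoord i c.natAbs
    have h1 : ((ℓ : ℤ) ^ c.natAbs).natAbs ≤ c.natAbs := Int.natAbs_le_of_dvd_ne_zero hk hne
    rw [Int.natAbs_pow, Int.natAbs_natCast] at h1
    exact absurd h1 (not_le.mpr (Nat.lt_pow_self (by omega)))
  have h0 : (⟨z, hz₀ ▸ hw₀⟩ : O) = 0 := b.repr.injective (by ext i; simp [hzero i])
  exact congrArg Subtype.val h0

omit [IsQuaternionAlgebra ℚ B] in
/-- **THE FILTRATION STEP** (Minkowski): `x^p = 1` with `p` prime, `x − 1 = ℓ^{k+1}·y` with `y ∈ O`, `ℓ` an odd prime ⟹ `x − 1 ∈ ℓ^{k+2}·O`.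
[cite: Brown1982CohomologyGroups, II.4 Exercise 3 (hint: «look at the binomial expansion of `(1 + p^d B)^l`»)] [cite: Serre1971CohomologieGroupesDiscrets, §1.8] -/
theorem sub_one_mem_pow_succ_smul (hO : Brandt.IsOrder B O) {ℓ : ℕ} (hℓ : ℓ.Prime) (hℓ2 : ℓ ≠ 2) {p : ℕ} (hp : p.Prime) {x : B}
    (hxp : x ^ p = 1) {k : ℕ} (hx : ∃ y ∈ O, x - 1 = ((ℓ : ℤ) ^ (k + 1)) • y) :
    ∃ y' ∈ O, x - 1 = ((ℓ : ℤ) ^ (k + 2)) • y' := by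
  haveI : IsAddTorsionFree B := isAddTorsionFree_of_charZero_module ℚ B
  obtain ⟨S, hS⟩ := exists_subring_coe_eq hO
  have hmemS : ∀ {a : B}, a ∈ S ↔ a ∈ O := fun {a} => by rw [← SetLike.mem_coe, hS, SetLike.mem_coe]
  obtain ⟨y, hy, hxy⟩ := hx
  have hy2 : y ^ 2 ∈ O := by rw [sq]; exact hO.mul_mem y hy y hy
  have hx1 : x = 1 + ((ℓ : ℤ) ^ (k + 1)) • y := by rw [← hxy]; abel
  obtain ⟨Z, hZ, hexp⟩ := exists_one_add_pow_eq_mem S (Y := ((ℓ : ℤ) ^ (k + 1)) • y) (by rw [hmemS]; exact O.smul_mem _ hy) p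
  have hy3Z : y ^ 3 * Z ∈ O := by
    rw [← hmemS] at hy ⊢
    exact S.mul_mem (S.pow_mem hy 3) hZ
  -- `p•Y + C(p,2)•Y² + Y³ Z = 0` for `Y = ℓ^{k+1} y`
  have hsum : p • (((ℓ : ℤ) ^ (k + 1)) • y) + (p.choose 2) • (((ℓ : ℤ) ^ (k + 1)) • y) ^ 2 +
      (((ℓ : ℤ) ^ (k + 1)) • y) ^ 3 * Z = 0 := by
    rw [← hx1, hxp] at hexp
    have h2 : (1 : B) + (p • (((ℓ : ℤ) ^ (k + 1)) • y) + (p.choose 2) • (((ℓ : ℤ) ^ (k + 1)) • y) ^ 2 +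
        (((ℓ : ℤ) ^ (k + 1)) • y) ^ 3 * Z) = 1 + 0 := by
      rw [add_zero, ← add_assoc, ← add_assoc]; exact hexp.symm
    exact add_left_cancel h2
  -- factor `ℓ^{k+1}`
  have hfac : p • (((ℓ : ℤ) ^ (k + 1)) • y) + (p.choose 2) • (((ℓ : ℤ) ^ (k + 1)) • y) ^ 2 + (((ℓ : ℤ) ^ (k + 1)) • y) ^ 3 * Z =
      ((ℓ : ℤ) ^ (k + 1)) • ((p : ℤ) • y + ((ℓ : ℤ) ^ (k + 1)) • (((p.choose 2 : ℕ) : ℤ) • y ^ 2 + ((ℓ : ℤ) ^ (k + 1)) • (y ^ 3 * Z))) := by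
    rw [smul_pow, smul_pow, smul_mul_assoc]
    module
  have hℓk : ((ℓ : ℤ) ^ (k + 1)) ≠ 0 := pow_ne_zero _ (by exact_mod_cast hℓ.ne_zero)
  have hkey : (p : ℤ) • y = -(((ℓ : ℤ) ^ (k + 1)) • (((p.choose 2 : ℕ) : ℤ) • y ^ 2 + ((ℓ : ℤ) ^ (k + 1)) • (y ^ 3 * Z))) := by
    rw [hfac] at hsum
    exact eq_neg_of_add_eq_zero_left ((smul_eq_zero.mp hsum).resolve_left hℓk)
  -- conclude `y ∈ ℓ • O`
  have hyℓ : ∃ y₁ ∈ O, y = (ℓ : ℤ) • y₁ := by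
    by_cases hpl : p = ℓ
    · subst hpl
      -- `C(p,2) = p m` (`p` odd)
      have hp2 : ¬ 2 ∣ p := fun h => hℓ2 ((Nat.prime_dvd_prime_iff_eq Nat.prime_two hp).mp h).symm
      obtain ⟨m, hm⟩ : ∃ m : ℕ, p.choose 2 = p * m := by
        refine ⟨(p - 1) / 2, ?_⟩
        rw [Nat.choose_two_right]
        have h2 : 2 ∣ p - 1 := by
          have : p % 2 = 1 := Nat.two_dvd_ne_zero.mp hp2
          omega
        exact Nat.mul_div_assoc p h2
      have hmZ : ((p.choose 2 : ℕ) : ℤ) = (p : ℤ) * (m : ℤ) := by rw [hm]; push_cast; ring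
      rw [hmZ] at hkey
      have hp0 : (p : ℤ) ≠ 0 := by exact_mod_cast hp.ne_zero
      refine ⟨-((((p : ℤ) ^ k) * m) • y ^ 2 + ((p : ℤ) ^ (2 * k)) • (y ^ 3 * Z)),
        O.neg_mem (O.add_mem (O.smul_mem _ hy2) (O.smul_mem _ hy3Z)), ?_⟩
      refine smul_right_injective B hp0 ?_
      change (p : ℤ) • y = (p : ℤ) • ((p : ℤ) • -((((p : ℤ) ^ k) * m) • y ^ 2 + ((p : ℤ) ^ (2 * k)) • (y ^ 3 * Z)))
      rw [hkey]
      module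
    · -- `p ≠ ℓ`: Bezout
      have hcop : Nat.Coprime p ℓ := (Nat.coprime_primes hp hℓ).mpr hpl
      obtain ⟨u, v, huv⟩ : ∃ u v : ℤ, u * p + v * ℓ = 1 := by
        have h := Nat.Coprime.gcd_eq_one hcop
        refine ⟨Nat.gcdA p ℓ, Nat.gcdB p ℓ, ?_⟩
        have h2 := (Nat.gcd_eq_gcd_ab p ℓ).symm
        rw [h] at h2
        push_cast at h2
        linarith [h2]
      refine ⟨-(u • (((ℓ : ℤ) ^ k) • (((p.choose 2 : ℕ) : ℤ) • y ^ 2 + ((ℓ : ℤ) ^ (k + 1)) • (y ^ 3 * Z)))) + v • y,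
        O.add_mem (O.neg_mem (O.smul_mem _ (O.smul_mem _ (O.add_mem (O.smul_mem _ hy2) (O.smul_mem _ hy3Z))))) (O.smul_mem _ hy), ?_⟩
      calc y = (u * p + v * ℓ) • y := by rw [huv, one_smul]
        _ = u • ((p : ℤ) • y) + (v * (ℓ : ℤ)) • y := by rw [add_smul, mul_smul]
        _ = (ℓ : ℤ) • (-(u • (((ℓ : ℤ) ^ k) • (((p.choose 2 : ℕ) : ℤ) • y ^ 2 + ((ℓ : ℤ) ^ (k + 1)) • (y ^ 3 * Z)))) + v • y) := by
          rw [hkey]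
          module
  obtain ⟨y₁, hy₁, hyy₁⟩ := hyℓ
  refine ⟨y₁, hy₁, ?_⟩
  rw [hxy, hyy₁, smul_smul, ← pow_succ]

/-- **MINKOWSKI FOR A PRIME EXPONENT**: `x ∈ O`, `x^p = 1` (`p` prime), `x ≡ 1 (mod ℓ O)` with `ℓ` an odd prime ⟹ `x = 1`.
[cite: Serre1971CohomologieGroupesDiscrets, §1.8] [cite: Brown1982CohomologyGroups, II.4 Exercise 3] -/
theorem eq_one_of_pow_prime_eq_one (hO : Brandt.IsOrder B O) {ℓ : ℕ} (hℓ : ℓ.Prime) (hℓ2 : ℓ ≠ 2) {p : ℕ} (hp : p.Prime) {x : B}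
    (hxp : x ^ p = 1) (hx : ∃ y ∈ O, x - 1 = (ℓ : ℤ) • y) : x = 1 := by
  have hall : ∀ k : ℕ, ∃ y ∈ O, x - 1 = ((ℓ : ℤ) ^ (k + 1)) • y := by
    intro k
    induction k with
    | zero => simpa using hx
    | succ k ih => exact sub_one_mem_pow_succ_smul hO hℓ hℓ2 hp hxp ih
  have h0 : x - 1 = 0 := by
    refine eq_zero_of_forall_mem_pow_smul hO hℓ.two_le fun k => ?_
    cases k with
    | zero =>
      obtain ⟨y, hy, hxy⟩ := hx
      exact ⟨(ℓ : ℤ) • y, O.smul_mem _ hy, by rw [pow_zero, one_smul, hxy]⟩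
    | succ k => exact hall k
  exact sub_eq_zero.mp h0

omit [Algebra ℚ B] [IsQuaternionAlgebra ℚ B] in
/-- Powers preserve the congruence `x ≡ 1 (mod ℓ O)`. [folklore] -/
theorem pow_sub_one_mem (hO : Brandt.IsOrder B O) {ℓ : ℕ} {x : B} (hx : ∃ y ∈ O, x - 1 = (ℓ : ℤ) • y) (n : ℕ) :
    ∃ y ∈ O, x ^ n - 1 = (ℓ : ℤ) • y := by
  obtain ⟨y, hy, hxy⟩ := hx
  have hxO : x ∈ O := by
    have : x = 1 + (ℓ : ℤ) • y := by rw [← hxy]; abel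
    rw [this]; exact O.add_mem hO.one_mem (O.smul_mem _ hy)
  induction n with
  | zero => exact ⟨0, O.zero_mem, by simp⟩
  | succ n ih =>
    obtain ⟨w, hw, hxn⟩ := ih
    refine ⟨w * x + y, O.add_mem (hO.mul_mem w hw x hxO) hy, ?_⟩
    have e : x ^ (n + 1) - 1 = (x ^ n - 1) * x + (x - 1) := by rw [pow_succ]; noncomm_ring
    rw [e, hxn, hxy, smul_mul_assoc, ← smul_add]

/-- **MINKOWSKI'S LEMMA FOR QUATERNION ORDERS**: an element `x ∈ O` of finite multiplicative order (`x^n = 1`, `n ≥ 1`) with `x ≡ 1 (mod ℓ O)`, `ℓ` an odd prime, is `1`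
(reduce to a prime exponent through `orderOf`). [cite: Serre1971CohomologieGroupesDiscrets, §1.8] [cite: Brown1982CohomologyGroups, II.4 Exercise 3] [cite: Bergeron2016, §2.3 Cor. 2.11 p. 44] -/
theorem eq_one_of_pow_eq_one_of_sub_one_mem (hO : Brandt.IsOrder B O) {ℓ : ℕ} (hℓ : ℓ.Prime) (hℓ2 : ℓ ≠ 2) {x : B} {n : ℕ} (hn : 0 < n)
    (hxn : x ^ n = 1) (hx : ∃ y ∈ O, x - 1 = (ℓ : ℤ) • y) : x = 1 := by
  by_contra hne
  have hfin : IsOfFinOrder x := isOfFinOrder_iff_pow_eq_one.mpr ⟨n, hn, hxn⟩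
  have hord : 1 < orderOf x := by
    have h1 : 0 < orderOf x := hfin.orderOf_pos
    have h2 : orderOf x ≠ 1 := fun h => hne (orderOf_eq_one_iff.mp h)
    omega
  obtain ⟨p, hp, hpd⟩ := Nat.exists_prime_and_dvd hord.ne'
  obtain ⟨m, hm⟩ := hpd
  have hm0 : 0 < m := Nat.pos_of_ne_zero fun h => by rw [h, mul_zero] at hm; exact hfin.orderOf_pos.ne' hm
  -- `x^m` has order `p` and is `≡ 1`
  have hxm1 : (x ^ m) ^ p = 1 := by rw [← pow_mul, mul_comm, ← hm, pow_orderOf_eq_one]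
  have hxm : x ^ m = 1 := eq_one_of_pow_prime_eq_one hO hℓ hℓ2 hp hxm1 (pow_sub_one_mem hO hx m)
  have hlt : m < orderOf x := by
    rw [hm]
    exact lt_mul_left hm0 hp.one_lt
  exact pow_ne_one_of_lt_orderOf hm0.ne' hlt hxm

end Minkowski

/-! ## §3 Torsion-free principal levels of `ι(O¹)` -/

section Groups

variable {B : Type*} [Ring B] [Algebra ℚ B] [IsQuaternionAlgebra ℚ B] (ι : B →ₐ[ℚ] Matrix (Fin 2) (Fin 2) ℝ) {O : Submodule ℤ B}

/-- **An element of finite order of `ι(O¹)` congruent to `1` modulo `ℓ O` (`ℓ` an odd prime) is the identity.** [cite: Serre1971CohomologieGroupesDiscrets, §1.8]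
[cite: Bergeron2016, §2.3 Cor. 2.11 p. 44 («principal congruence subgroups of level ≥ 3 are torsion-free»)] -/
theorem eq_one_of_isOfFinOrder_of_sub_one_mem (hι : Function.Injective ι) (hO : Brandt.IsOrder B O) {ℓ : ℕ} (hℓ : ℓ.Prime) (hℓ2 : ℓ ≠ 2)
    {γ : GL (Fin 2) ℝ} (hfin : IsOfFinOrder γ) (hx : ∃ x ∈ O, ι x = (γ : Matrix (Fin 2) (Fin 2) ℝ) ∧ ∃ y ∈ O, x - 1 = (ℓ : ℤ) • y) : γ = 1 := by
  obtain ⟨x, -, hxγ, hy⟩ := hx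
  obtain ⟨n, hn, hγn⟩ := hfin.exists_pow_eq_one
  have hxn : x ^ n = 1 := hι (by rw [map_pow, hxγ, ← Units.val_pow_eq_pow_val, hγn, Units.val_one, map_one])
  have hx1 : x = 1 := eq_one_of_pow_eq_one_of_sub_one_mem hO hℓ hℓ2 hn hxn hy
  exact Units.ext (by rw [← hxγ, hx1, map_one, Units.val_one])

variable {D M : ℕ} {C : Finset ℕ} (X : CartanLevelCurveData D M C) (q : ℕ)

/-- **THE PRINCIPAL LEVEL-`q` SUBGROUP `Γ̄(q)` OF THE COVER GROUP IS TORSION-FREE for an odd prime `q`** (`CartanCover.principalLevel X q`: `ι(x)` with `x ∈ O₀'¹`,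
`x ≡ 1 (mod q O₀')`). [cite: Bergeron2016, §2.3 Cor. 2.11 p. 44] [cite: Serre1971CohomologieGroupesDiscrets, §1.8] -/
theorem principalLevel_torsionFree (hq : q.Prime) (hq2 : q ≠ 2) {γ : GL (Fin 2) ℝ} (hγ : γ ∈ principalLevel X q) (hfin : IsOfFinOrder γ) : γ = 1 := by
  obtain ⟨-, x, hx, hxγ, y, hy, hxy⟩ := hγ
  exact eq_one_of_isOfFinOrder_of_sub_one_mem X.ι X.ι_injective (isOrder_coverOrder X q) hq hq2 hfin ⟨x, hx, hxγ, y, hy, hxy⟩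

/-- The same for elements of the subgroup type. [cite: Bergeron2016, §2.3 Cor. 2.11 p. 44] -/
theorem principalLevel_torsionFree' (hq : q.Prime) (hq2 : q ≠ 2) (γ : principalLevel X q) (hfin : IsOfFinOrder γ) : γ = 1 := by
  have hfin' : IsOfFinOrder (γ : GL (Fin 2) ℝ) := (principalLevel X q).subtype.isOfFinOrder hfin
  have h := principalLevel_torsionFree X q hq hq2 γ.2 hfin'
  exact Subtype.ext h

/-- **`−1 ∉ Γ̄(q)`** for an odd prime `q` (it has order `2`). [cite: Bergeron2016, §2.3 Cor. 2.11 p. 44] -/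
theorem neg_one_not_mem_principalLevel (hq : q.Prime) (hq2 : q ≠ 2) : (-1 : GL (Fin 2) ℝ) ∉ principalLevel X q := by
  intro h
  have h2 : IsOfFinOrder (-1 : GL (Fin 2) ℝ) := isOfFinOrder_iff_pow_eq_one.mpr ⟨2, two_pos, by rw [neg_one_sq]⟩
  have h1 := principalLevel_torsionFree X q hq hq2 h h2
  have h3 : ((-1 : GL (Fin 2) ℝ) : Matrix (Fin 2) (Fin 2) ℝ) 0 0 = ((1 : GL (Fin 2) ℝ) : Matrix (Fin 2) (Fin 2) ℝ) 0 0 := by rw [h1]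
  simp at h3
  norm_num at h3

/-- **`Γ̄(q)` ACTS FREELY where stabilisers are finite**: if the stabiliser of `τ ∈ ℍ` in `Γ̄(q)` is finite (true for every point: `Γ̄(q)` is discrete — tree
`properlyDiscontinuousSMul_coverUnits`), then `γ • τ = τ` forces `γ = 1`. [cite: Bergeron2016, §2.3 p. 44 and p. 52] -/
theorem smul_eq_self_iff_eq_one_of_finite_stabilizer (hq : q.Prime) (hq2 : q ≠ 2) (τ : UpperHalfPlane)
    (hfin : (MulAction.stabilizer (principalLevel X q) τ : Set (principalLevel X q)).Finite) (γ : principalLevel X q) :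
    γ • τ = τ ↔ γ = 1 := by
  constructor
  · intro h
    have hmem : γ ∈ MulAction.stabilizer (principalLevel X q) τ := h
    -- an element of a finite subgroup has finite order
    haveI : Finite (MulAction.stabilizer (principalLevel X q) τ) := hfin.to_subtype
    have hfo : IsOfFinOrder (⟨γ, hmem⟩ : MulAction.stabilizer (principalLevel X q) τ) := isOfFinOrder_of_finite _
    have hfo' : IsOfFinOrder γ := (MulAction.stabilizer (principalLevel X q) τ).subtype.isOfFinOrder hfo
    exact principalLevel_torsionFree' X q hq hq2 γ hfo'
  · rintro rfl; exact one_smul _ _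

end Groups

end Summit.BirchSwinnertonDyer.BirchSwinnertonDyer.Theorems.CartanCover.PrintClauses

end
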